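import Summits.BirchSwinnertonDyer.BirchSwinnertonDyer.Theorems.EisensteinPrimesBSDpOnCellCOfCitedFactsR3
import Summits.BirchSwinnertonDyer.BirchSwinnertonDyer.Theorems.EisensteinPrimesBSDpOnCellCOfNamedFactsV22LZZ
import Summits.BirchSwinnertonDyer.BirchSwinnertonDyer.Theorems.EisensteinPrimesBSDpOnCellCTelescopeWeightTwoPseudoNullOfPub22
import Summits.BirchSwinnertonDyer.BirchSwinnertonDyer.Theorems.EisensteinPrimesBSDpOnCellCTelescopeK2WeightTwoControlOfPub22
import HarnessLib

/-!
# [telescope v21 — LEAD cruxlead-19034 g9, 2026-08-30; CAS-lane] CRUX 4 `BSDpOnCellC` FROM THE CITED FACTS WITHOUT CASTELLA 2018 THMS. 2.10–2.11 — CONDITIONAL CLOSURE, SORRY-FREE (sibling of p783713 with ONE `hPub` CONJUNCT FEWER; `--supports`, helper)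

Crux 4 `BSDpOnCellC` (stmt-BirchSwinnertonDyer-19034), line «telescope» v21. WHAT: `bsdpOnCellC_of_citedFactsR5 (hPub) (hPre) (hRat) (hMazur) : …Theses.EisensteinPrimes.BSDpOnCellC` with `hPre`/`hRat`/`hMazur`
EXACTLY as in p783713 and **`hPub` = telescope v21ʼs `stub_publishedFacts` text with EXACTLY ONE conjunct removed — `Castella2018Exceptional.thm210_thm211_bdpDisplay_pNew` — every other conjunct
token-identical and in the same nesting** (22 refereed named facts). PROOF = the v21 composition term with the head ↦ CAS-3ʼs `…OfNamedFactsV22LZZ.bsdpOnCellC_of_namedFactsV22P_allP` and the N2 slot ↦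
CAS-4ʼs `weightTwoControlOfPub_of_pseudoNull_lzz stub_weightTwoPseudoNullOfPub_lzz hPub`; the analytic slot, FPGM glue, N1/N3″ and Herbrand theorems BY NAME as in p783713.
MEANING (host (K3′)/(2) l.7385): on the TYPED register a REDUNDANCY removal — the value atoms at every `p` come from the refereed LZZ fact already cited (conjunct 15); by-name 26 → 25 /
refereed 22 → 21 is bookable ONLY by the host on this landed file, print watch h-W-CAS-1 first; the cumulative closure (minus every departed conjunct) and any telescope v22 are ONE later item / ONE director word.
HOST WATCH h-W-CAS-1 (print side, not a kernel matter): the typed LZZ fact carries no `5 ≤ p` binder (`p ∣ N`, `¬ p² ∣ N`, `p` split in `K`);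
whether LZZ Duke 167 Thms. 1.5.1/1.5.3 need a bound on `p` beyond Assumption 1.8.1 is a referee page-check booked by the host BEFORE any count moves.
HONEST FRAMING: theorems only (no definition, no named fact, no instance, no `sorry`); every theorem here is a TWIN of a landed tree theorem with
ONE hypothesis conjunct fewer (proof token-identical up to the projections/branches named below); CONDITIONAL on its remaining hypotheses;
closes no registered stub, no crux, no summit statement; moves no count by itself (the by-name register is re-booked, if at all, by the host on the
landed closure `…OfCitedFactsR5` and a telescope re-cut is a LEAD act under a NEW director word); BSD is proved for no curve by this file.
References (shape only): [cite: Castella2018Exceptional, Thm. 2.10 and Thm. 2.11 (arXiv:1507.04260 pp. 13–14)] [cite: LiuZhangZhang2018, Thm. 1.5.1 and Thm. 1.5.3 (Duke Math. J. 167 pp. 745–749)]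
-/

set_option autoImplicit false
set_option linter.dupNamespace false

noncomputable section

open scoped Classical MatrixGroups ModularForm

open CongruenceSubgroup WeierstrassCurve NumberField IsDedekindDomain Field PowerSeries
  Literature.NumberTheory.EllipticCurves Literature.NumberTheory.EllipticCurves.GreenbergSelmer
  Literature.NumberTheory.EllipticCurves.ModularForms Literature.NumberTheory.QuadraticFields
  Literature.NumberTheory.EllipticCurves.Rank1Residual
  Literature.NumberTheory.EllipticCurves.Rank1Residual.Typed
  Literature.NumberTheory.EllipticCurves.KrizLi2019
  Literature.NumberTheory.EllipticCurves.GreenbergVatsal2000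
  Literature.NumberTheory.EllipticCurves.Wuthrich2014
  Literature.NumberTheory.EllipticCurves.SteinWuthrich2013
  Literature.NumberTheory.EllipticCurves.Castella2018Exceptional
  Literature.NumberTheory.GaloisRepresentations Literature.NumberTheory.GaloisCohomology
  Literature.NumberTheory.Automorphic
  Summit.BirchSwinnertonDyer.Rank1Residual.X11b.AcSelmer
  Summit.BirchSwinnertonDyer.Rank1Residual.X11b.Halves
  Summit.BirchSwinnertonDyer.Rank1Residual.X11b
  Summit.BirchSwinnertonDyer.Rank1Residual Summit.BirchSwinnertonDyer.Rank1Residual.X1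
  Summit.BirchSwinnertonDyer.Rank1Residual.X2
open Literature.NumberTheory.EllipticCurves.KellerYin2024 (curveLocalLambda)


open Literature.NumberTheory.EllipticCurves.BigGaloisRep

namespace Summit.BirchSwinnertonDyer.BirchSwinnertonDyer.Theorems.EisensteinPrimesBSDpOnCellCOfCitedFactsR5

open Literature.NumberTheory.EllipticCurves.CastellaGrossiLeeSkinner2022 Literature.NumberTheory.EllipticCurves.Castella2018
  Literature.NumberTheory.IwasawaTheory Literature.NumberTheory.IwasawaTheory.Greenberg2016
  Literature.NumberTheory.IwasawaTheory.Greenberg2006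
  Summit.BirchSwinnertonDyer.Rank1Residual.X1.KellerYinMuLambdaSplit
open Literature.NumberTheory.EllipticCurves.KellerYin2024
open Summit.BirchSwinnertonDyer.BirchSwinnertonDyer.Theorems

/-- **Crux 4 `BSDpOnCellC` from 22 refereed facts (NO Castella 2018 Thms. 2.10–2.11), Keller–Yin ×3, T-An-2ʳ and crux 3 (telescope v21 chain; conditional closure).** `hPub` = v21ʼs `stub_publishedFacts` text minus EXACTLY `thm210_thm211_bdpDisplay_pNew`; `hPre`/`hRat`/`hMazur` as in p783713; proof = the v21 composition over the CAS-lane twins. CONDITIONAL: nothing here discharges the hypotheses. [cite: Castella2018Exceptional, Thm. 2.10 and Thm. 2.11 (shape only)] [cite: LiuZhangZhang2018, Thm. 1.5.1 and Thm. 1.5.3 (shape only)] [cite: KellerYin2024, Thm. 3.0.8 (shape only)] -/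
theorem bsdpOnCellC_of_citedFactsR5
    (hPub :
    (((lambdaMu_multiplicative_of_gvPar ∧ thm16_charIdeal_dvd_multiplicative_of_reducible ∧
    thm61_splitMultiplicative ∧ thm61_nonsplitMultiplicative ∧
    (∀ (W : WeierstrassCurve ℚ) [W.IsElliptic] [W.IsGloballyMinimal] (p : ℕ) [Fact p.Prime],
      greenberg_stevens (W := W) (p := p)) ∧
    exists_isNewformOf ∧
    hsieh2014_exists_anticyclotomicPAdicLFunction ∧
    (∀ (N : ℕ) [NeZero N] (W : WeierstrassCurve ℚ) (K : Type) [Field K] [NumberField K],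
      gross_zagier N W K) ∧
    (∀ (N : ℕ) [NeZero N] (W : WeierstrassCurve ℚ) (K : Type) [Field K] [NumberField K],
      kolyvagin N W K) ∧
    rank_eq_analyticRank_of_analyticRank_le_one ∧ HoffsteinLuo1997_exists_twist_L_one_ne_zero ∧
    mazur_not_dvd_maninConstant_of_odd ∧ bsdRHS_eq_of_isIsogenous) ∧
    LiuZhangZhang2018.thm151_thm153_modularCurve_heegnerVector) ∧
    (prop125_characterGrSelmerDual_torsion_muZero_dim ∧
      cor126_residualCharacter_globalLift ∧ cor126_residualCharacter_localSurjective ∧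
      thm212_exists_isKatzLFunction ∧
      Literature.NumberTheory.EllipticCurves.Castella2018.cas20_thm211_memberForms_sigmaFrames_congr)) ∧
      Literature.NumberTheory.EllipticCurves.BCGKPST2020.thm331_rubin_exists_katzMeasure₂_pseudoIso_span_eq ∧
      Literature.NumberTheory.EllipticCurves.DeShalit1987.thmII64_katzMeasure₂_functionalEquation ∧
      Literature.NumberTheory.EllipticCurves.Hida2010MuInvariant.thmI_mu_katzBranch_reflect_eq_zero)
    (hPre :
    Literature.NumberTheory.EllipticCurves.KellerYin2024.thm308_imc2_hidaMember_dvd_OPEN ∧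
      Literature.NumberTheory.EllipticCurves.KellerYin2024.thm222_anacong_hidaMember_sigma_mu_OPEN ∧
      Literature.NumberTheory.EllipticCurves.KellerYin2024.thm222_anacong_hidaMember_sigma_lambda_OPEN)
    (hRat : Literature.NumberTheory.EllipticCurves.hida1986_castella2020_exists_rationalMembers_on_pNewBranchChart)
    (hMazur :
    Summit.BirchSwinnertonDyer.BirchSwinnertonDyer.Theses.EisensteinPrimes.MazurMCOnCellB) :
    Summit.BirchSwinnertonDyer.BirchSwinnertonDyer.Theses.EisensteinPrimes.BSDpOnCellC :=
  EisensteinPrimesBSDpOnCellCOfNamedFactsV22LZZ.bsdpOnCellC_of_namedFactsV22P_allP hPub hPre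
    (Summit.BirchSwinnertonDyer.BirchSwinnertonDyer.Theorems.TelescopeCarrierOfAnDistRatOfAlgFPG.carrier_of_anDistRat_of_algFP
      (Summit.BirchSwinnertonDyer.BirchSwinnertonDyer.Theorems.TelescopeCarrierAnDistRatGalOfGaloisLattice.carrierAnDistRatGal_of_galoisLattice
        (Summit.BirchSwinnertonDyer.BirchSwinnertonDyer.Theorems.TelescopeBranchGaloisLatticeOfUntwistedFact.galoisLattice_of_untwistedGaloisLattice
          (Summit.BirchSwinnertonDyer.BirchSwinnertonDyer.Theorems.TelescopeBranchUntwistedOfFrobenius.untwistedGaloisLattice_of_frobeniusGaloisLattice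
            (Summit.BirchSwinnertonDyer.BirchSwinnertonDyer.Theorems.TelescopeBranchFrobeniusLatticeOfChart.frobeniusGaloisLattice_of_rationalMembers
              hRat))))
      (Summit.BirchSwinnertonDyer.BirchSwinnertonDyer.Theorems.TelescopeCarrierAlgOfWitnessFPG.carrierAlg_of_witness
        (Summit.BirchSwinnertonDyer.BirchSwinnertonDyer.Theorems.TelescopeCarrierAlgWOfDivIntFPG.carrierAlgW_of_divInt
          (Summit.BirchSwinnertonDyer.BirchSwinnertonDyer.Theorems.TelescopeK2DivIntOfModuleDivFPG.carrierDivInt_of_branchFibreDiv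
            (Summit.BirchSwinnertonDyer.BirchSwinnertonDyer.Theorems.TelescopeK2ModuleDivOfLeavesFPGM.branchFibreDiv_of_leaves_of_modCofinite
              Summit.BirchSwinnertonDyer.BirchSwinnertonDyer.Theorems.TelescopeBranchLatticeOfPkgG.branchLattice_of_pkgG
              (TelescopeK2WeightTwoControlOfPub22.weightTwoControlOfPub_of_pseudoNull_lzz
                TelescopeWeightTwoPseudoNullOfPub22.stub_weightTwoPseudoNullOfPub_lzz
                hPub)
              Summit.BirchSwinnertonDyer.BirchSwinnertonDyer.Theorems.TelescopeMemberControlModCofinite.stub_memberControlModCofinite)))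
        Summit.BirchSwinnertonDyer.BirchSwinnertonDyer.Theorems.TelescopeHerbrandTranslate.stub_herbrandTranslate))
    hMazur

end Summit.BirchSwinnertonDyer.BirchSwinnertonDyer.Theorems.EisensteinPrimesBSDpOnCellCOfCitedFactsR5

end
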